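import Summits.NavierStokesRegularity.FluidComputer.GateBudgetLeakFloor
import HarnessLib

/-!
# What no tuning can beat, part 71: THE LEAK FLOOR (ii) — THE LEAK LAW OF ONE PULSE: on the
# lattice `ε = kK¹⁰ρ²` every pulse of the headline member entered at clock radius `≤ θ₁ε` and
# pinned to `Φ(T') = kπ ± δ` leaks `ã(T') - ã(r) ≥ ((a(r)² + d(r)²)π/2 - δ - δ²)/((θ₁ + 1/500)K⁹)
# - 1/(600K⁹)` of output — the lattice index `k` CANCELS (SPEC-INPUT-bp1 §BE(4)(i), lower side)

Cell `pub-fluidc`, blueprint seat bp1 (gen 36, first item, file 2 of 3); same namespace and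
conventions as parts 1–70 (`GateBudget*.lean`); imports part 70 (`GateBudgetLeakFloor`: §215
`leakPrim_pin`, §216 `leak_floor`). Independent of parts 15–69 (the uniform pin slip of part 63
§196 is re-derived in §217 rather than imported). Headline knob family `rotorCircuit K K¹⁰ ε ρ`
from (5.6) (`σ = ρ²e^{-K¹⁰}`, `μ = ε⁻¹K¹⁰`; modes `0 = a` carrier, `1 = b` clock, `2 = c`
trigger, `3 = d` transfer, `4 = ã` output) from `delayInit`, with a trigger primitive `C`
(`C' = c`, a hypothesis as in parts 49–70; no integral is typed). HONEST FRAMING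
(verbatim): low prior, high value-of-information experiment on Tao's machine paradigm;
NOT a claim that NS blows up. Nothing is proved about the Navier–Stokes equations.

## Why (SPEC-INPUT-bp1 §BE(4)(i))

Part 70 §216 bounds the output of any stretch `[r, T']` with a trigger cap `c ≤ c_M` from below
by `(Kρ²/c_M)·(G(Φ(T')) - G(0)) - 6KL(T' - r)²`, and §215 evaluates the primitive at a pin:
`G(Φ) - G(0) ≥ AΦ/2 - δ/2 - δ²` (`A = a(r)² + d(r)²`, `|Φ - kπ| ≤ δ`). On a PULSE of the
headline member three facts make this a floor. (1) The trigger cap: the pulse keeps the clock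
radius (`|Δ(b² + c²)| ≤ ε²/10⁶`, part 52 §153 / part 61 §190), so from an entry radius
`b(r)² + c(r)² ≤ (θ₁² + 10⁻⁶)ε²` the trigger obeys `c ≤ c_M := (θ₁ + 1/500)ε` throughout.
(2) The lattice: `ε = kK¹⁰ρ²` turns `Kρ²/c_M` into `1/((θ₁ + 1/500)kK⁹)`, and the pin puts
`Φ(T') ≥ kπ - δ`, so `(Kρ²/c_M)·(AΦ/2 - δ/2 - δ²) ≥ (Aπ/2 - δ - δ²)/((θ₁ + 1/500)K⁹)`
(using `k ≥ 1`; the product `k·(1/k)` is where the lattice index cancels — a long pulse turns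
the carrier `k` half-times as slowly in output per radian, and exactly as many more radians).
(3) The drift error: `L = ε + ρ²e^{-K¹⁰} + Kã(T') ≤ K + 1/8` (`ã ≤ 1`, `ε, σ ≤ 1/K¹⁰`) and
`T' - r ≤ 242/K⁹` give `6KL(T' - r)² ≤ 6K(K + 1/8)·242²/K¹⁸ ≤ 1/(600K⁹)` for `K ≥ 16`. §217
`leak_numerics` supplies, uniformly on the lattice window `200ε/K²⁰ ≤ ρ²` (`⇒ 200k ≤ K¹⁰`), the
size of the misfire slip `δ₀ = kπ/((25/16 - 10⁻⁶)K¹⁰ - 1) + 1/K¹⁹ ≤ 1/80` that part 52 §154's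
pin produces at a normal-form ignition (part 72 consumes it). Heuristic truth, for comparison
(NOT proved): with the clock angle `α` the trigger runs through `θε sin α` while the phase runs
through `kα`, so `Δã ≈ (A/(θK⁹))∫₀^π sin²(kα + ψ)/sin α dα ≥ Aπ/(2θK⁹)`; at `k = 1`, `ψ = 0`
this is `2A/(θK⁹) ≈ 1.45/K⁹` — the law below keeps `≈ 70 %` and ignores the `log k` growth.

## What is proved

* §217 `leak_numerics`: `K ≥ 16`, `0 < ε`, `0 < ρ`, `200ε/K²⁰ ≤ ρ²`, `ε = kK¹⁰ρ²` (`k : ℕ`) ⇒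
  `1 ≤ k`, `200k ≤ K¹⁰`, `0 < (25/16 - 10⁻⁶)K¹⁰ - 1`, `0 ≤ δ₀ ≤ 1/80`, `243/K⁹ ≤ 10⁻⁸`.
* §217 `knob_pulse_leak` (THE LEAK LAW OF ONE PULSE): headline member from `delayInit` with a
  trigger primitive `C`; `K ≥ 16`, `0 < ε`, `ε² ≤ 1/(6K²⁰)`, `0 < ρ`, `K¹⁰ρ² ≤ 2ε`,
  `ε = kK¹⁰ρ²`; `0 ≤ r ≤ T'`, `T' - r ≤ 242/K⁹`; `0 ≤ θ₁`, `b(r)² + c(r)² ≤ (θ₁² + 10⁻⁶)ε²`;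
  `|b(t)² + c(t)² - (b(r)² + c(r)²)| ≤ ε²/10⁶` on `[r, T']`; `0 ≤ δ`,
  `|(C(T') - C(r))/ρ² - kπ| ≤ δ` ⇒ `ã(r) + ((a(r)² + d(r)²)π/2 - δ - δ²)/((θ₁ + 1/500)K⁹) -
  1/(600K⁹) ≤ ã(T')`.

HONEST LIMITS. (i) A floor `≈ 70 %` of the heuristic truth at `k = 1`, blind to the `log k`
enhancement; no ceiling is proved here (parts 52/63 give `242/K⁸` per rung and the fine chain
of parts 65–67 `O(log K/K⁹)`, both from `d² ≤ 1` over the pulse; a phase-resolved ceiling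
matching this floor up to constants is open in this series); (ii) the hypotheses are exactly
what part 61 §190 (exit data, kept radius) and part 52 §154 (the pin) certify at a normal-form
ignition — part 72 does that bookkeeping; away from such pulses the law is silent; (iii) headline
family `M = K¹⁰`, `K ≥ 16`, lattice `ε = kK¹⁰ρ²` only; (iv) nothing about Navier–Stokes.
[cite: Tao2016AveragedNS, §5.5 Theorem 5.3, (5.5), (5.6), (b-eq), (c-eq), (ta-eq), (energy-con)]
-/

namespace Summit.NavierStokesRegularity.FluidComputer.GateBudget

open Real Set
open Literature.Analysis.FluidPDE.Tao2016AveragedNS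

variable {K ε ρ : ℝ} {X : ℝ → Fin 5 → ℝ} {C : ℝ → ℝ}

/-! ## §217 The leak law of one pulse -/

/-- §217 NUMERICS of the leak law: `K ≥ 16`, `0 < ε`, `0 < ρ`, `200ε/K²⁰ ≤ ρ²`, `ε = kK¹⁰ρ²`
(`k : ℕ`) ⇒ `1 ≤ k`, `200k ≤ K¹⁰`, the uniform pin denominator is positive, the uniform misfire
slip `δ₀ = kπ/((25/16 - 10⁻⁶)K¹⁰ - 1) + 1/K¹⁹` lies in `[0, 1/80]`, and `243/K⁹ ≤ 10⁻⁸`.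
[derived: this file §217; cf. part 52 §155 `pulse_slip_uniform`] -/
theorem leak_numerics (hK : 16 ≤ K) (hε : 0 < ε) (hρ : 0 < ρ)
    (hlo : 200 * ε / K ^ 20 ≤ ρ ^ 2) (k : ℕ) (hk : ε = k * K ^ 10 * ρ ^ 2) :
    (1 : ℝ) ≤ k ∧ 200 * (k : ℝ) ≤ K ^ 10 ∧ 0 < (25 / 16 - 1 / 10 ^ 6) * K ^ 10 - 1 ∧
      0 ≤ k * π / ((25 / 16 - 1 / 10 ^ 6) * K ^ 10 - 1) + 1 / K ^ 19 ∧
      k * π / ((25 / 16 - 1 / 10 ^ 6) * K ^ 10 - 1) + 1 / K ^ 19 ≤ 1 / 80 ∧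
      243 / K ^ 9 ≤ 1 / 10 ^ 8 := by
  have hK0 : (0 : ℝ) < K := by linarith
  have hK10 : (2 : ℝ) ^ 40 ≤ K ^ 10 := by
    calc (2 : ℝ) ^ 40 = 16 ^ 10 := by norm_num
      _ ≤ K ^ 10 := pow_le_pow_left₀ (by norm_num) hK 10
  have hK9 : (2 : ℝ) ^ 36 ≤ K ^ 9 := by
    calc (2 : ℝ) ^ 36 = 16 ^ 9 := by norm_num
      _ ≤ K ^ 9 := pow_le_pow_left₀ (by norm_num) hK 9
  have hK19 : (2 : ℝ) ^ 76 ≤ K ^ 19 := by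
    calc (2 : ℝ) ^ 76 = 16 ^ 19 := by norm_num
      _ ≤ K ^ 19 := pow_le_pow_left₀ (by norm_num) hK 19
  have hk0 : (0 : ℝ) ≤ k := Nat.cast_nonneg k
  have hkne : k ≠ 0 := by
    rintro rfl
    simp at hk
    linarith
  have hk1 : (1 : ℝ) ≤ k := by exact_mod_cast Nat.one_le_iff_ne_zero.2 hkne
  have hK20 : (0 : ℝ) < K ^ 20 := by positivity
  have hk200 : 200 * (k : ℝ) ≤ K ^ 10 := by
    rw [hk, div_le_iff₀ hK20] at hlo
    have e1 : 200 * (k * K ^ 10 * ρ ^ 2) = 200 * k * (ρ ^ 2 * K ^ 10) := by ring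
    have e2 : ρ ^ 2 * K ^ 20 = K ^ 10 * (ρ ^ 2 * K ^ 10) := by ring
    rw [e1, e2] at hlo
    exact le_of_mul_le_mul_right hlo (by positivity)
  have hD : 0 < (25 / 16 - 1 / 10 ^ 6) * K ^ 10 - 1 := by nlinarith only [hK10]
  have hδ0 : 0 ≤ k * π / ((25 / 16 - 1 / 10 ^ 6) * K ^ 10 - 1) + 1 / K ^ 19 := by
    have : 0 ≤ k * π / ((25 / 16 - 1 / 10 ^ 6) * K ^ 10 - 1) :=
      div_nonneg (mul_nonneg hk0 Real.pi_pos.le) hD.le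
    positivity
  refine ⟨hk1, hk200, hD, hδ0, ?_, ?_⟩
  · have hkπ : (k : ℝ) * π ≤ k * 3.1416 := mul_le_mul_of_nonneg_left Real.pi_lt_d4.le hk0
    have h1 : k * π / ((25 / 16 - 1 / 10 ^ 6) * K ^ 10 - 1) ≤ 21 / 2000 := by
      rw [div_le_iff₀ hD]
      nlinarith only [hkπ, hk200, hK10]
    have h2 : 1 / K ^ 19 ≤ 1 / 2 ^ 76 :=
      div_le_div_of_nonneg_left (by norm_num) (by positivity) hK19
    have h2' : (1 : ℝ) / 2 ^ 76 ≤ 1 / 500 := by norm_num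
    linarith only [h1, h2, h2']
  · rw [div_le_div_iff₀ (by positivity) (by norm_num)]
    nlinarith only [hK9]

/-- §217 THE LEAK LAW OF ONE PULSE (SPEC-INPUT-bp1 §BE(4)(i), the lower side). Headline member
from `delayInit` with a trigger primitive `C`, `K ≥ 16`, `0 < ε`, `ε² ≤ 1/(6K²⁰)`, `0 < ρ`,
`K¹⁰ρ² ≤ 2ε`, on the lattice `ε = kK¹⁰ρ²` (`k : ℕ`). Let `0 ≤ r ≤ T'`, `T' - r ≤ 242/K⁹`, the
entry radius `b(r)² + c(r)² ≤ (θ₁² + 10⁻⁶)ε²` (`θ₁ ≥ 0`), the kept radius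
`|Δ(b² + c²)| ≤ ε²/10⁶` on `[r, T']`, and the pin `|(C(T') - C(r))/ρ² - kπ| ≤ δ`. Then
`ã(T') ≥ ã(r) + ((a(r)² + d(r)²)π/2 - δ - δ²)/((θ₁ + 1/500)K⁹) - 1/(600K⁹)`:
EVERY PINNED PULSE LEAKS `≍ 1/K⁹` OF OUTPUT — the trigger is capped by `c_M = (θ₁ + 1/500)ε`
on the pulse, so the dose phase advances at rate `≤ c_M/ρ² = (θ₁ + 1/500)kK¹⁰`, and while it
advances by `≈ kπ` the squared turned carrier integrates to `(a(r)² + d(r)²)kπ/2 + O(δ)`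
(§215: the pin kills the oscillatory part); `k` cancels. [derived: this file §215/§216;
part 14 §43; Tao2016AveragedNS (5.5), (5.6)] -/
theorem knob_pulse_leak
    (hX : ∀ t, HasDerivAt X (RotorKnob.rotorCircuit K (K ^ 10) ε ρ (X t)) t)
    (h0 : X 0 = delayInit) (hC : ∀ t, HasDerivAt C (X t 2) t) (hK : 16 ≤ K) (hε : 0 < ε)
    (hεK : ε ^ 2 ≤ 1 / (6 * K ^ 20)) (hρ : 0 < ρ) (hhi : K ^ 10 * ρ ^ 2 ≤ 2 * ε) (k : ℕ)
    (hk : ε = k * K ^ 10 * ρ ^ 2) {r T' θ₁ δ : ℝ} (hr0 : 0 ≤ r) (hrT : r ≤ T')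
    (hτ : T' - r ≤ 242 / K ^ 9) (hθ₁ : 0 ≤ θ₁)
    (hbc : X r 1 ^ 2 + X r 2 ^ 2 ≤ (θ₁ ^ 2 + 1 / 10 ^ 6) * ε ^ 2)
    (hkept : ∀ t ∈ Icc r T', |X t 1 ^ 2 + X t 2 ^ 2 - (X r 1 ^ 2 + X r 2 ^ 2)| ≤ ε ^ 2 / 10 ^ 6)
    (hpin : |(C T' - C r) / ρ ^ 2 - k * π| ≤ δ) :
    X r 4 + ((X r 0 ^ 2 + X r 3 ^ 2) * π / 2 - δ - δ ^ 2) / ((θ₁ + 1 / 500) * K ^ 9)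
      - 1 / (600 * K ^ 9) ≤ X T' 4 := by
  have hK0 : (0 : ℝ) < K := by linarith
  have hδ : 0 ≤ δ := (abs_nonneg _).trans hpin
  have hk0 : (0 : ℝ) ≤ k := Nat.cast_nonneg k
  have hkne : k ≠ 0 := by
    rintro rfl
    simp at hk
    linarith
  have hk1 : (1 : ℝ) ≤ k := by exact_mod_cast Nat.one_le_iff_ne_zero.2 hkne
  -- (1) the trigger cap `c ≤ c_M = (θ₁ + 1/500)ε` on the pulse, from the kept radius
  obtain ⟨cM, hcM_def⟩ : ∃ cM : ℝ, cM = (θ₁ + 1 / 500) * ε := ⟨_, rfl⟩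
  have hcM : 0 < cM := by rw [hcM_def]; positivity
  have hcap : ∀ t ∈ Icc r T', X t 2 ≤ cM := by
    intro t ht
    have h1 := (abs_le.1 (hkept t ht)).2
    have hθε : 0 ≤ θ₁ * ε ^ 2 := by positivity
    have h2 : X t 2 ^ 2 ≤ ((θ₁ + 1 / 500) * ε) ^ 2 := by
      nlinarith only [h1, hbc, sq_nonneg (X t 1), hθε, sq_nonneg ε]
    rw [hcM_def]
    have h4 : |X t 2| ≤ |(θ₁ + 1 / 500) * ε| := sq_le_sq.1 h2
    rw [abs_of_pos (by positivity : (0 : ℝ) < (θ₁ + 1 / 500) * ε)] at h4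
    exact (le_abs_self _).trans h4
  -- (2) the comparison of §216
  have hfl := leak_floor hX h0 hC hε.le hK0.le hρ hr0 hrT hcM hcap
  -- (3) the pin value of §215
  have ha1 : X r 0 ^ 2 ≤ 1 := RotorKnob.traj_sq_le_one hX h0 r 0
  have hd1 : X r 3 ^ 2 ≤ 1 := RotorKnob.traj_sq_le_one hX h0 r 3
  have hG := leakPrim_pin k ha1 hd1 hpin
  have hΦ : k * π - δ ≤ (C T' - C r) / ρ ^ 2 := by
    have := (abs_le.1 hpin).1
    linarith only [this]
  have hA1 : X r 0 ^ 2 + X r 3 ^ 2 ≤ 1 := by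
    have := RotorKnob.traj_sum_sq_eq_one hX h0 r
    nlinarith only [this, sq_nonneg (X r 1), sq_nonneg (X r 2), sq_nonneg (X r 4)]
  obtain ⟨A, hA⟩ : ∃ A : ℝ, A = X r 0 ^ 2 + X r 3 ^ 2 := ⟨_, rfl⟩
  rw [← hA] at hA1 hG ⊢
  have hA0 : 0 ≤ A := by rw [hA]; positivity
  -- (4) `Kρ²/c_M = 1/((θ₁ + 1/500)kK⁹)` on the lattice
  have hpos : 0 < (θ₁ + 1 / 500) * K ^ 9 := by positivity
  have hposk : 0 < (θ₁ + 1 / 500) * k * K ^ 9 := by positivity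
  have hκ : K * ρ ^ 2 / cM = 1 / ((θ₁ + 1 / 500) * k * K ^ 9) := by
    rw [hcM_def, hk, div_eq_div_iff (by positivity) hposk.ne']
    ring
  have hmain : (A * π / 2 - δ - δ ^ 2) / ((θ₁ + 1 / 500) * K ^ 9)
      ≤ K * ρ ^ 2 / cM * (leakPrim (X r 0) (X r 3) ((C T' - C r) / ρ ^ 2)
        - leakPrim (X r 0) (X r 3) 0) := by
    rw [hκ, one_div_mul_eq_div]
    have h1 : k * (A * π / 2 - δ - δ ^ 2) ≤ A * ((C T' - C r) / ρ ^ 2) / 2 - δ / 2 - δ ^ 2 := by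
      have e1 := mul_le_mul_of_nonneg_left hΦ hA0
      have e2 := mul_nonneg (sub_nonneg.2 hk1) hδ
      have e3 := mul_nonneg (sub_nonneg.2 hk1) (sq_nonneg δ)
      have e4 := mul_nonneg (sub_nonneg.2 hA1) hδ
      nlinarith only [e1, e2, e3, e4, hδ, sq_nonneg δ]
    calc (A * π / 2 - δ - δ ^ 2) / ((θ₁ + 1 / 500) * K ^ 9)
        = k * (A * π / 2 - δ - δ ^ 2) / ((θ₁ + 1 / 500) * k * K ^ 9) := by
          rw [div_eq_div_iff hpos.ne' hposk.ne']
          ring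
      _ ≤ (A * ((C T' - C r) / ρ ^ 2) / 2 - δ / 2 - δ ^ 2) / ((θ₁ + 1 / 500) * k * K ^ 9) :=
          div_le_div_of_nonneg_right h1 hposk.le
      _ ≤ (leakPrim (X r 0) (X r 3) ((C T' - C r) / ρ ^ 2) - leakPrim (X r 0) (X r 3) 0)
            / ((θ₁ + 1 / 500) * k * K ^ 9) := div_le_div_of_nonneg_right hG hposk.le
  -- (5) the drift error `6KL(T' - r)² ≤ 1/(600K⁹)`
  have herr : 6 * K * (ε + ρ ^ 2 * exp (-K ^ 10) + K * X T' 4) * (T' - r) ^ 2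
      ≤ 1 / (600 * K ^ 9) := by
    have hT0 : 0 ≤ T' := hr0.trans hrT
    have he1 : X T' 4 ≤ 1 := (abs_le.1 (RotorKnob.traj_abs_le_one hX h0 T' 4)).2
    have he0 : 0 ≤ X T' 4 := RotorKnob.e_nonneg hX h0 hK0.le hT0
    have hK10 : (2 : ℝ) ^ 40 ≤ K ^ 10 := by
      calc (2 : ℝ) ^ 40 = 16 ^ 10 := by norm_num
        _ ≤ K ^ 10 := pow_le_pow_left₀ (by norm_num) hK 10
    have hK7 : (2 : ℝ) ^ 28 ≤ K ^ 7 := by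
      calc (2 : ℝ) ^ 28 = 16 ^ 7 := by norm_num
        _ ≤ K ^ 7 := pow_le_pow_left₀ (by norm_num) hK 7
    have hK10pos : (0 : ℝ) < K ^ 10 := by positivity
    have hε1 : ε ≤ 1 / K ^ 10 := by
      have hK20 : (0 : ℝ) < K ^ 20 := by positivity
      have e : (1 / K ^ 10) ^ 2 = 1 / K ^ 20 := by
        rw [div_pow, one_pow, ← pow_mul]
      have h : ε ^ 2 ≤ (1 / K ^ 10) ^ 2 := by
        rw [e]
        exact hεK.trans (div_le_div_of_nonneg_left (by norm_num) hK20
          (by linarith only [hK20.le]))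
      exact (pow_le_pow_iff_left₀ hε.le (by positivity) two_ne_zero).1 h
    have hεhalf : ε ≤ 1 / 2 := hε1.trans (by
      rw [div_le_div_iff₀ hK10pos (by norm_num)]; nlinarith only [hK10])
    have hρ1 : ρ ^ 2 * exp (-K ^ 10) ≤ 1 / K ^ 10 := by
      have e1 : exp (-K ^ 10) ≤ 1 := exp_le_one_iff.2 (by
        have : (0 : ℝ) ≤ K ^ 10 := by positivity
        linarith only [this])
      have e2 : ρ ^ 2 * exp (-K ^ 10) ≤ ρ ^ 2 :=
        (mul_le_mul_of_nonneg_left e1 (by positivity)).trans_eq (mul_one _)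
      have e3 : ρ ^ 2 ≤ 1 / K ^ 10 := by
        rw [le_div_iff₀ hK10pos]
        nlinarith only [hhi, hεhalf]
      exact e2.trans e3
    have hL : ε + ρ ^ 2 * exp (-K ^ 10) + K * X T' 4 ≤ K + 1 / 8 := by
      have e1 : 1 / K ^ 10 ≤ (1 : ℝ) / 2 ^ 40 :=
        div_le_div_of_nonneg_left (by norm_num) (by positivity) hK10
      have e2 : K * X T' 4 ≤ K * 1 := mul_le_mul_of_nonneg_left he1 hK0.le
      have e3 : (1 : ℝ) / 2 ^ 40 ≤ 1 / 16 := by norm_num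
      linarith only [hε1, hρ1, e1, e2, e3]
    have hL0 : 0 ≤ ε + ρ ^ 2 * exp (-K ^ 10) + K * X T' 4 := by positivity
    have hτ0 : 0 ≤ T' - r := by linarith only [hrT]
    have hτ2 : (T' - r) ^ 2 ≤ (242 / K ^ 9) ^ 2 := pow_le_pow_left₀ hτ0 hτ 2
    calc 6 * K * (ε + ρ ^ 2 * exp (-K ^ 10) + K * X T' 4) * (T' - r) ^ 2
        ≤ 6 * K * (K + 1 / 8) * (242 / K ^ 9) ^ 2 := by
          have := mul_le_mul hL hτ2 (sq_nonneg _) (by positivity)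
          nlinarith only [this, hK0]
      _ = 6 * 242 ^ 2 * ((K + 1 / 8) * K) / K ^ 18 := by
          field_simp
      _ ≤ 1 / (600 * K ^ 9) := by
          rw [div_le_div_iff₀ (by positivity) (by positivity)]
          have e1 : (2 : ℝ) ^ 28 * K ^ 11 ≤ K ^ 7 * K ^ 11 :=
            mul_le_mul_of_nonneg_right hK7 (by positivity)
          have e2 : 16 * K ^ 10 ≤ K * K ^ 10 := mul_le_mul_of_nonneg_right hK (by positivity)
          have e3 : (0 : ℝ) ≤ K ^ 10 := by positivity
          have e4 : (0 : ℝ) ≤ K ^ 11 := by positivity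
          nlinarith only [e1, e2, e3, e4]
  linarith only [hfl, hmain, herr]

/-! ## §218 The leak law of a rung of the misfire ladder -/

end Summit.NavierStokesRegularity.FluidComputer.GateBudget
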